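import Literature.MathematicalPhysics.QuantumFieldTheory.BalabanImbrieJaffe1984to88.BIJ88TrainsDsetExpansion306

/-!
# `BalabanImbrieJaffe1984to88.BIJ88TrainTermBound307` — T. Bałaban, J. Imbrie, A. Jaffe, *Effective action and cluster properties of the
abelian Higgs model*, Commun. Math. Phys. **114** (1988) 257–315 [BalabanImbrieJaffe1988]: pp. 306–307 [PDF 50–51] (Sect. 5.13) and p. 309
[PDF 53] ((5.14.3)–(5.14.4)) — **THE SIZE OF ONE TERM OF THE WALK EXPANSION: THE TRAIN COEFFICIENT TIMES A PRODUCT OF SLOT COSTS, THE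
SHELL INDICATORS OF THE HIT χ-SLOTS KEPT**.  Print, p. 307: *"Altogether we have small factors at each end of C_ω(α) … Functional derivatives
hitting χ-factors … are supported at |A^{(k)″}| ≥ cp(e_k) … Functional derivatives hitting e^{−V^{(k)}(Y)} yield factors e^β(L^kε/ε₀)^{1/4−α}"*;
p. 309 (p0053 L21–28): *"Each t-derivative of a χ-factor in χ′_{Λ,t} gives at least a factor e^β(L^kε/ε₀)^{1/4−α} … the n-th derivative in t of
χ(cp(e_k), A^{(k)}) is bounded by t^{−n} times a function bounded by a constant and supported in c₁p(te_k) ≤ |A^{(k)}| ≤ c₂p(te_k). After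
integration over A^{(k)}, we obtain factors ct^{−n}e^{−cp(te_k)²}"*.

After `BIJ88TrainsDsetExpansion306.trains_apply_eq_sum_dset` (trains = `Σ_E trainCoef · ∂_{legs}`), `BIJ88CubeProductDset306` (one cube assignment)
and `BIJ88ProductRuleAllOrders306` (one slot assignment), a term of the located (5.13.3) is `trainCoef f K E · Π_τ (∂_{D_τ} slot_τ)(ω)`.  THIS FILE
bounds such a term in the shape `BIJ88GaussShellInterpolated309.abs_gexp_prec_le_shell` consumes (`|G ω| ≤ M · 1_S(ω)`):
* §1 **the train coefficient** `trainCoef f K E = Π_k [(K_kℱ)(p_k) | ½K_k(p_k,q_k)]` from entrywise certificates `|K_k(p,q)| ≤ κ_k(p,q)` (the walk-kernel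
  bounds of `BIJ88WalkKernelDecay307` / `BIJ88WalkKeptDecay307`) and a source letter `|ℱ_q| ≤ F_q`: `|trainCoef f K E| ≤ Π_k [Σ_q κ_k(p_k,q)F_q | ½κ_k(p_k,q_k)]`
  (`abs_mulVec_apply_le`, `abs_trainCoef_le`).
* §2 **a product of slot costs keeps the indicators of the hit slots**: `|a_τ(ω)| ≤ c_τ·w_τ(ω)` with `0 ≤ w_τ ≤ 1` ⇒ `|Π_τ a_τ(ω)| ≤ (Π_τ c_τ)·Π_{τ∈H} w_τ(ω)`
  for ANY sub-family `H` of the slots (`abs_prod_le_prod_mul_prod`, `prod_le_prod_filter_of_le_one`, `abs_prod_le_prod_mul_prod_filter`), and a product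
  of shell indicators is the indicator of the joint shell event (`prod_indicator_one_eq_indicator_iInter`); so a SUM over assignments whose every
  term keeps the indicators of a common family `H` (the `t`-differentiated χ-slots — hit under every assignment) is `≤ (Σ_g Π_τ c_{g,τ}) · 1{joint shell of H}`
  (`abs_sum_prod_le_indicator`) — the `θ^{|H|}` bookkeeping of the located (5.14.4): one Gaussian shell factor per `t`-differentiated χ-slot whatever
  the legs do.

(v1.1 DOC-ONLY, referee finding D-g80-1 extended / owner docfix D-owner-v2.365: the p. 309 quotation in this header corrected to the printed
sentences — the unprinted «(l_kε)^{1/2−4α} … (l_kε)^{1/2} e^{−p(e_k)²/4}» wording removed; declarations byte-identical to v1 p368872.)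

statement-level skeleton of published theorems with citation tags; proofs where landed; nothing here is a claim about the Yang–Mills mass gap

PDF held: `paper:balaban1988-cmp114-bij-abelian-higgs-effective-action` (journal page = PDF page + 256); pages re-read this session as text:
PDF 51 (p. 307) L8–18, PDF 53 (p. 309) L1–15.

CITATION HEADER (lean-in-tree rule).  Part of the lit-balaban TYPED SKELETON (HOME `run/shared/lean/pub/lit-balaban/`), Phase 2, seat p36
(gen 21, unit `lit-balaban-p36`); rows **C2.Eq5.14.3-5.14.4** (member: §f estimate E4c/E4d glue — the per-term integrand bound) and C2.Eq5.13.3-5.13.4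
(member) of `HOME/lit-balaban-r16/ROWS-C2-part2.md` (owner r16, referee ref-5).  Theorem-only; no definitions, no `Prop` facts; axioms standard.
HONEST SCOPE.  Inequalities only; which constants `c_τ`, `κ_k`, `F_q` are small is the business of the files that supply them.
-/

namespace Literature.MathematicalPhysics.QuantumFieldTheory.BalabanImbrieJaffe1984to88.BIJ88TrainTermBound307

open Finset Matrix
open scoped BigOperators
open BIJ88TrainsDsetExpansion306 (trainCoef)

/-! ## §1  The train coefficient from entrywise certificates -/

section Coef

variable {S : Type} [Fintype S]

/-- `|(Kℱ)(p)| ≤ Σ_q κ(p,q)·F_q` from `|K(p,q)| ≤ κ(p,q)` and `|ℱ_q| ≤ F_q`. [cite: BalabanImbrieJaffe1988, §5.13 p.306–307] -/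
theorem abs_mulVec_apply_le {K : Matrix S S ℝ} {κ : S → S → ℝ} {f F : S → ℝ} (hK : ∀ p q, |K p q| ≤ κ p q) (hf : ∀ q, |f q| ≤ F q)
    (p : S) : |(K *ᵥ f) p| ≤ ∑ q, κ p q * F q := by
  rw [Matrix.mulVec, dotProduct]
  refine (abs_sum_le_sum_abs _ _).trans (sum_le_sum fun q _ => ?_)
  rw [abs_mul]
  exact mul_le_mul (hK p q) (hf q) (abs_nonneg _) ((abs_nonneg _).trans (hK p q))

/-- **THE TRAIN COEFFICIENT**: `|trainCoef ℱ K E| ≤ Π_k [Σ_q κ_k(p_k,q)F_q  if train k ends in the source at p_k | ½κ_k(p_k,q_k) if it ends in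
∂_{p_k}∂_{q_k}]` — each train costs the certified size of its walk kernel at its two ends (p. 307 *"small factors at each end of C_ω(α)"*, supplied
by `BIJ88WalkKernelDecay307`/`BIJ88WalkKeptDecay307` through `κ_k`). [cite: BalabanImbrieJaffe1988, §5.13 p.306–307] -/
theorem abs_trainCoef_le {m : ℕ} {f F : S → ℝ} {K : Fin m → Matrix S S ℝ} {κ : Fin m → S → S → ℝ}
    (hK : ∀ k p q, |K k p q| ≤ κ k p q) (hf : ∀ q, |f q| ≤ F q) (E : Fin m → S ⊕ (S × S)) :
    |trainCoef f K E| ≤ ∏ k, Sum.elim (fun p => ∑ q, κ k p q * F q) (fun pq => (1 / 2 : ℝ) * κ k pq.1 pq.2) (E k) := by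
  rw [trainCoef, abs_prod]
  refine prod_le_prod (fun k _ => abs_nonneg _) fun k _ => ?_
  rcases hE : E k with p | pq
  · simp only [Sum.elim_inl]
    exact abs_mulVec_apply_le (hK k) hf p
  · simp only [Sum.elim_inr]
    rw [abs_mul, abs_of_nonneg (by norm_num : (0 : ℝ) ≤ 1 / 2)]
    exact mul_le_mul_of_nonneg_left (hK k pq.1 pq.2) (by norm_num)

end Coef

/-! ## §2  Products of slot costs keep the indicators of the hit slots -/

section Slots

variable {T : Type*} {Ω : Type*}

/-- `|Π_τ a_τ(ω)| ≤ (Π_τ c_τ)·Π_τ w_τ(ω)` from `|a_τ(ω)| ≤ c_τ·w_τ(ω)`. [cite: BalabanImbrieJaffe1988, §5.13 p.307] -/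
theorem abs_prod_le_prod_mul_prod (s : Finset T) {a w : T → Ω → ℝ} {c : T → ℝ}
    (h : ∀ τ ∈ s, ∀ ω, |a τ ω| ≤ c τ * w τ ω) (ω : Ω) : |∏ τ ∈ s, a τ ω| ≤ (∏ τ ∈ s, c τ) * ∏ τ ∈ s, w τ ω := by
  rw [abs_prod, ← prod_mul_distrib]
  exact prod_le_prod (fun τ _ => abs_nonneg _) fun τ hτ => h τ hτ ω

/-- dropping factors `≤ 1`: `Π_{τ∈s} w_τ ≤ Π_{τ∈s, P τ} w_τ` for `0 ≤ w_τ ≤ 1`. [cite: BalabanImbrieJaffe1988, §5.13 p.307] -/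
theorem prod_le_prod_filter_of_le_one (s : Finset T) (P : T → Prop) [DecidablePred P] {w : T → ℝ} (h0 : ∀ τ ∈ s, 0 ≤ w τ)
    (h1 : ∀ τ ∈ s, w τ ≤ 1) : ∏ τ ∈ s, w τ ≤ ∏ τ ∈ s.filter P, w τ := by
  classical
  rw [← prod_filter_mul_prod_filter_not s P]
  exact mul_le_of_le_one_right (prod_nonneg fun τ hτ => h0 τ (mem_of_mem_filter τ hτ))
    (prod_le_one (fun τ hτ => h0 τ (mem_of_mem_filter τ hτ)) fun τ hτ => h1 τ (mem_of_mem_filter τ hτ))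

/-- **the hit slots keep their weights**: `|a_τ(ω)| ≤ c_τ·w_τ(ω)`, `0 ≤ w_τ ≤ 1`, `0 ≤ c_τ` ⇒ `|Π_{τ∈s} a_τ(ω)| ≤ (Π_{τ∈s} c_τ)·Π_{τ∈s, P τ} w_τ(ω)` for any
selection `P` of slots (the `t`-differentiated χ-slots). [cite: BalabanImbrieJaffe1988, §5.13 p.307, (5.14.4) p.309] -/
theorem abs_prod_le_prod_mul_prod_filter (s : Finset T) (P : T → Prop) [DecidablePred P] {a w : T → Ω → ℝ} {c : T → ℝ}
    (hc : ∀ τ ∈ s, 0 ≤ c τ) (hw0 : ∀ τ ∈ s, ∀ ω, 0 ≤ w τ ω) (hw1 : ∀ τ ∈ s, ∀ ω, w τ ω ≤ 1) (h : ∀ τ ∈ s, ∀ ω, |a τ ω| ≤ c τ * w τ ω)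
    (ω : Ω) : |∏ τ ∈ s, a τ ω| ≤ (∏ τ ∈ s, c τ) * ∏ τ ∈ s.filter P, w τ ω :=
  (abs_prod_le_prod_mul_prod s h ω).trans (mul_le_mul_of_nonneg_left
    (prod_le_prod_filter_of_le_one s P (fun τ hτ => hw0 τ hτ ω) fun τ hτ => hw1 τ hτ ω) (prod_nonneg hc))

/-- **a product of shell indicators is the indicator of the joint shell event**: `Π_{τ∈H} 1_{S_τ}(ω) = 1_{⋂_{τ∈H} S_τ}(ω)`.
[cite: BalabanImbrieJaffe1988, §5.13 p.307] -/
theorem prod_indicator_one_eq_indicator_iInter (H : Finset T) (Sh : T → Set Ω) (ω : Ω) :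
    ∏ τ ∈ H, (Sh τ).indicator (1 : Ω → ℝ) ω = (⋂ τ ∈ H, Sh τ).indicator (1 : Ω → ℝ) ω := by
  classical
  by_cases hω : ω ∈ ⋂ τ ∈ H, Sh τ
  · rw [Set.indicator_of_mem hω, Pi.one_apply]
    refine prod_eq_one fun τ hτ => ?_
    rw [Set.indicator_of_mem (Set.mem_iInter₂.1 hω τ hτ), Pi.one_apply]
  · rw [Set.indicator_of_notMem hω]
    obtain ⟨τ, hτ, hωτ⟩ : ∃ τ ∈ H, ω ∉ Sh τ := by
      by_contra hall
      exact hω (Set.mem_iInter₂.2 fun τ hτ => by_contra fun hn => hall ⟨τ, hτ, hn⟩)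
    exact prod_eq_zero hτ (Set.indicator_of_notMem hωτ _)

/-- indicators are weights in `[0,1]`. [folklore] [cite: BalabanImbrieJaffe1988, §5.13 p.307] -/
theorem indicator_one_mem_Icc (Sh : Set Ω) (ω : Ω) : 0 ≤ Sh.indicator (1 : Ω → ℝ) ω ∧ Sh.indicator (1 : Ω → ℝ) ω ≤ 1 := by
  by_cases h : ω ∈ Sh
  · rw [Set.indicator_of_mem h, Pi.one_apply]; exact ⟨zero_le_one, le_rfl⟩
  · rw [Set.indicator_of_notMem h]; exact ⟨le_rfl, zero_le_one⟩

/-- **ONE TERM, SHELLS KEPT**: slot costs `|a_τ(ω)| ≤ c_τ·1_{S_τ}(ω)` on the hit slots `τ ∈ s, P τ` and `|a_τ(ω)| ≤ c_τ` on the others give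
`|Π_{τ∈s} a_τ(ω)| ≤ (Π_{τ∈s} c_τ) · 1_{⋂_{τ∈s, Pτ} S_τ}(ω)` — the shape `BIJ88GaussShellInterpolated309.abs_gexp_prec_le_shell` integrates.
[cite: BalabanImbrieJaffe1988, §5.13 p.307, (5.14.4) p.309] -/
theorem abs_prod_le_prod_mul_indicator (s : Finset T) (P : T → Prop) [DecidablePred P] {a : T → Ω → ℝ} {c : T → ℝ} (Sh : T → Set Ω)
    (hc : ∀ τ ∈ s, 0 ≤ c τ) (hhit : ∀ τ ∈ s, P τ → ∀ ω, |a τ ω| ≤ c τ * (Sh τ).indicator 1 ω) (hfree : ∀ τ ∈ s, ¬ P τ → ∀ ω, |a τ ω| ≤ c τ)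
    (ω : Ω) : |∏ τ ∈ s, a τ ω| ≤ (∏ τ ∈ s, c τ) * (⋂ τ ∈ s.filter P, Sh τ).indicator (1 : Ω → ℝ) ω := by
  classical
  -- weights: the indicator on the hit slots, `1` on the free ones
  let w : T → Ω → ℝ := fun τ ω => if P τ then (Sh τ).indicator 1 ω else 1
  have hw0 : ∀ τ ∈ s, ∀ ω, 0 ≤ w τ ω := fun τ _ ω => by
    simp only [w]; split_ifs
    · exact (indicator_one_mem_Icc _ _).1
    · exact zero_le_one
  have hw1 : ∀ τ ∈ s, ∀ ω, w τ ω ≤ 1 := fun τ _ ω => by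
    simp only [w]; split_ifs
    · exact (indicator_one_mem_Icc _ _).2
    · exact le_rfl
  have h : ∀ τ ∈ s, ∀ ω, |a τ ω| ≤ c τ * w τ ω := fun τ hτ ω => by
    simp only [w]; split_ifs with hP
    · exact hhit τ hτ hP ω
    · rw [mul_one]; exact hfree τ hτ hP ω
  refine (abs_prod_le_prod_mul_prod_filter s P hc hw0 hw1 h ω).trans (le_of_eq ?_)
  congr 1
  rw [← prod_indicator_one_eq_indicator_iInter]
  exact prod_congr rfl fun τ hτ => by simp only [w, if_pos (mem_filter.1 hτ).2]

/-- **A SUM OVER ASSIGNMENTS, COMMON SHELLS KEPT**: if every term `g ∈ 𝒢` satisfies `|t_g(ω)| ≤ M_g · 1_{S}(ω)` for one event `S` (the joint shell of the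
`t`-differentiated χ-slots, hit under EVERY assignment of the legs) then `|Σ_g t_g(ω)| ≤ (Σ_g M_g) · 1_S(ω)` — the `θ^{|H|}` of the located (5.14.4) survives
the Leibniz sums. [cite: BalabanImbrieJaffe1988, (5.14.4) p.309] -/
theorem abs_sum_le_sum_mul_indicator {G : Type*} (𝒢 : Finset G) {t : G → Ω → ℝ} {M : G → ℝ} (Sh : Set Ω)
    (h : ∀ g ∈ 𝒢, ∀ ω, |t g ω| ≤ M g * Sh.indicator 1 ω) (ω : Ω) : |∑ g ∈ 𝒢, t g ω| ≤ (∑ g ∈ 𝒢, M g) * Sh.indicator (1 : Ω → ℝ) ω := by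
  rw [sum_mul]
  exact (abs_sum_le_sum_abs _ _).trans (sum_le_sum fun g hg => h g hg ω)

/-- monotonicity in the event: a bound with the indicator of `S` is a bound with the indicator of any `S′ ⊇ S` (coarsen the joint shell of all
hit slots to the joint shell of the `t`-differentiated ones). [cite: BalabanImbrieJaffe1988, (5.14.4) p.309] -/
theorem mul_indicator_le_mul_indicator_of_subset {Sh Sh' : Set Ω} (hS : Sh ⊆ Sh') {M : ℝ} (hM : 0 ≤ M) (ω : Ω) :
    M * Sh.indicator (1 : Ω → ℝ) ω ≤ M * Sh'.indicator (1 : Ω → ℝ) ω :=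
  mul_le_mul_of_nonneg_left (Set.indicator_le_indicator_of_subset hS (fun _ => zero_le_one) ω) hM

end Slots

end Literature.MathematicalPhysics.QuantumFieldTheory.BalabanImbrieJaffe1984to88.BIJ88TrainTermBound307
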